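import Summits.ABC.ABC.Theses.CuspFieldPencil
import Literature.Barriers.ABC.BakerMethodBounds

/-! Sanity (planner, stub-ideation k3 g2): proofs of the XS helper statements G3, G4, G5 of `Sketch_g2.lean`. -/

set_option linter.dupNamespace false

namespace SanityK3G2

open UniqueFactorizationMonoid Literature.Barriers.ABC

theorem rpow_regime_glue {m q : ℝ} (hm : 1 ≤ m) (hq : 0 ≤ q) (h : m ≤ q ^ 2) :
    m ≤ q ^ (2 / 3 : ℝ) * m ^ (2 / 3 : ℝ) := by
  have hm0 : 0 < m := by linarith
  have h1 : m = m ^ (1 / 3 : ℝ) * m ^ (2 / 3 : ℝ) := by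
    rw [← Real.rpow_add hm0]; norm_num
  have h2 : m ^ (1 / 3 : ℝ) ≤ q ^ (2 / 3 : ℝ) := by
    calc m ^ (1 / 3 : ℝ) ≤ (q ^ 2) ^ (1 / 3 : ℝ) := Real.rpow_le_rpow hm0.le h (by norm_num)
      _ = q ^ (2 / 3 : ℝ) := by
          rw [show (q ^ 2 : ℝ) = q ^ (2 : ℝ) by norm_num, ← Real.rpow_mul hq]; norm_num
  have h3 : 0 ≤ m ^ (2 / 3 : ℝ) := Real.rpow_nonneg hm0.le _
  calc m = m ^ (1 / 3 : ℝ) * m ^ (2 / 3 : ℝ) := h1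
    _ ≤ q ^ (2 / 3 : ℝ) * m ^ (2 / 3 : ℝ) := by gcongr

theorem largestPrimeFactor_le_natAbs_radical (n : ℤ) (hn : n ≠ 0) :
    largestPrimeFactor n.natAbs ≤ (radical n).natAbs := by
  rw [← Int.radical_natAbs_eq_radical, Int.natAbs_natCast, largestPrimeFactor_def,
    Nat.radical_eq_prod_primeFactors]
  refine max_le ?_ ?_
  · exact Finset.prod_pos fun p hp => (Nat.prime_of_mem_primeFactors hp).pos
  · refine Finset.sup_le fun p hp => ?_
    exact Nat.le_of_dvd (Finset.prod_pos fun p hp => (Nat.prime_of_mem_primeFactors hp).pos)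
      (Finset.dvd_prod_of_mem _ hp)

theorem aux_degenerate_iff (u w : ℤ) (hcop : IsCoprime u w) (h0 : u * w * (u ^ 2 - 11 * u * w - w ^ 2) ≠ 0) :
    (u * (u - 11 * w) = 0 ∨ w * (11 * u + w) = 0) ↔
      ((u = 11 ∧ w = 1) ∨ (u = -11 ∧ w = -1) ∨ (u = 1 ∧ w = -11) ∨ (u = -1 ∧ w = 11)) := by
  have hu : u ≠ 0 := fun h => h0 (by rw [h]; ring)
  have hw : w ≠ 0 := fun h => h0 (by rw [h]; ring)
  constructor
  · rintro (h | h)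
    · have h' : u = 11 * w := by
        rcases mul_eq_zero.mp h with h | h
        · exact absurd h hu
        · linarith
      have hunit : IsUnit w := by
        rw [h'] at hcop
        exact hcop.isUnit_of_dvd' (dvd_mul_left w 11) dvd_rfl
      rcases Int.isUnit_iff.mp hunit with rfl | rfl
      · left; constructor <;> omega
      · right; left; constructor <;> omega
    · have h' : w = -11 * u := by
        rcases mul_eq_zero.mp h with h | h
        · exact absurd h hw
        · linarith
      have hunit : IsUnit u := by
        rw [h'] at hcop
        exact hcop.isUnit_of_dvd' dvd_rfl (dvd_mul_left u (-11))
      rcases Int.isUnit_iff.mp hunit with rfl | rfl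
      · right; right; left; constructor <;> omega
      · right; right; right; constructor <;> omega
  · rintro (⟨rfl, rfl⟩ | ⟨rfl, rfl⟩ | ⟨rfl, rfl⟩ | ⟨rfl, rfl⟩) <;> norm_num

end SanityK3G2
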